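import Mathlib.Analysis.SpecialFunctions.Pow.Real
import Mathlib.Analysis.SpecificLimits.Basic
import Literature.Analysis.FluidPDE.LatticeShearWords
import HarnessLib

/-!
# Template asymptotics for the K1L tail step: the stream-potential scale of the omitted levels is `o(kbar_j)`

Helper file for crux K1L `LagrangianRenormalisationStep` (stmt-AnomalousDissipation-24912), registered stub `stub_tailL` (plan
`STUB-PLAN-tailL-K1L.md`, evidence #30 on the item, brick (f)).  The stream-form stability estimate (cell literature lane,
`PassiveVectorTensorStreamStability`) makes the tail step small in the ratio `Λ_j / kbar_j`, `Λ_j` = sup of the stream potential of the omitted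
levels `m > j`.  Up to level-independent factors (slot count, `1/(2π²)`, the squared distortion `9μ²`) the potential scale of level `m` is
`p_m := a_m / N_m²` (`…LagrangianCarrierStreamPotential`: a rescaled layer of rate `a` in cells `1/N` has potential `≤ a/(2π² N² |m|²)`).  This file
proves, from the bookkeeping clauses alone (`FractalCarrierData.Permissible`: the Taylor recursion `kbar m = kbar (m+1)(1 + gain a²/(kbar² N⁴))`;
the template clause (T2) `cellVisc (m+1) (N(m+1)/N m)^{1/4} ≤ 1`; super-geometry `N m² ≤ N (m+1)`):

* `p_{m+1} = kbar_{m+1} / cellVisc_{m+1}` and `p_{m+1} / kbar_m ≤ cellVisc_{m+1} / gain` (`potentialScale_div_kbar_le`);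
* `cellVisc_{m+1} ≤ N_m^{-1/4} ≤ 2^{-m/4}` (`cellVisc_succ_le_inv_rpow`, `cellVisc_succ_le_half_pow`);
* consecutive potential scales contract: `p_{m+2} ≤ (cellVisc_{m+2} cellVisc_{m+1} / gain) p_{m+1}` (`potentialScale_succ_le`);
so the velocity AMPLITUDE ratio `a_{m+1}/(N_{m+1} kbar_m)` may diverge while the POTENTIAL ratio tends to zero — the quantitative reason the tail
step must be run in stream form (cell STATUS 2026-08-28T08:1xZ).  Pure real arithmetic; no definitions, no named facts, no sorry.
Prover seat `ad-solenoidal-k2r-lowerlaw-p1` g5, 2026-08-28.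
-/

set_option linter.dupNamespace false

noncomputable section

namespace Summit.AnomalousDissipation.AnomalousDissipation.Theorems.SolenoidalFractalHomogenisation.LagrangianRenormalisationStep

open Literature.Analysis.FluidPDE.LatticeShear

variable {k : ℕ} (D : FractalCarrierData k)

/-- Positivity of the cell viscosity `kbar_m N_m² / a_m`. [folklore] -/
theorem cellVisc_pos' (m : ℕ) : 0 < D.cellVisc m := by
  unfold FractalCarrierData.cellVisc
  exact div_pos (mul_pos (D.kbar_pos m) (by have := D.N_pos m; positivity)) (D.a_pos m)

/-- The potential scale is `kbar / cellVisc`: `a_m / N_m² = kbar_m / cellVisc_m`. [folklore] -/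
theorem potentialScale_eq (m : ℕ) : D.a m / (D.N m : ℝ) ^ 2 = D.kbar m / D.cellVisc m := by
  unfold FractalCarrierData.cellVisc
  have hN : (0 : ℝ) < D.N m := by exact_mod_cast D.N_pos m
  have ha := D.a_pos m
  have hk := D.kbar_pos m
  field_simp

/-- **The Taylor recursion bounds `kbar_m` from below by the gain of level `m+1`**: `gain · a_{m+1}² / (kbar_{m+1} N_{m+1}⁴) ≤ kbar_m`.
[cite: ArmstrongVicol2025, §3 (3.42)–(3.43) (the recursion of the renormalised diffusivities)] -/
theorem gainTerm_le_kbar (hP : D.Permissible) (m : ℕ) :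
    D.gain * D.a (m + 1) ^ 2 / (D.kbar (m + 1) * (D.N (m + 1) : ℝ) ^ 4) ≤ D.kbar m := by
  have hrec := hP.2.2.2.1 m
  have hk := D.kbar_pos (m + 1)
  have hN : (0 : ℝ) < D.N (m + 1) := by exact_mod_cast D.N_pos (m + 1)
  rw [hrec, mul_add, mul_one]
  have e : D.kbar (m + 1) * (D.gain * D.a (m + 1) ^ 2 / (D.kbar (m + 1) ^ 2 * (D.N (m + 1) : ℝ) ^ 4)) =
      D.gain * D.a (m + 1) ^ 2 / (D.kbar (m + 1) * (D.N (m + 1) : ℝ) ^ 4) := by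
    field_simp
  rw [e]
  linarith

/-- **Potential scale over renormalised viscosity**: `(a_{m+1}/N_{m+1}²) / kbar_m ≤ cellVisc_{m+1} / gain`.
[cite: ArmstrongVicol2025, §3 (3.42)–(3.43)] -/
theorem potentialScale_div_kbar_le (hP : D.Permissible) (m : ℕ) :
    D.a (m + 1) / (D.N (m + 1) : ℝ) ^ 2 / D.kbar m ≤ D.cellVisc (m + 1) / D.gain := by
  have hk := D.kbar_pos m
  have hk' := D.kbar_pos (m + 1)
  have hg := D.gain_pos
  have ha := D.a_pos (m + 1)
  have hN : (0 : ℝ) < D.N (m + 1) := by exact_mod_cast D.N_pos (m + 1)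
  have hlow := gainTerm_le_kbar D hP m
  -- `p / kbar_m ≤ p / (gain a² /(kbar' N⁴)) = kbar' N² / (gain a) = cellVisc' / gain`
  have hpos : 0 < D.gain * D.a (m + 1) ^ 2 / (D.kbar (m + 1) * (D.N (m + 1) : ℝ) ^ 4) := by positivity
  calc D.a (m + 1) / (D.N (m + 1) : ℝ) ^ 2 / D.kbar m
      ≤ D.a (m + 1) / (D.N (m + 1) : ℝ) ^ 2 / (D.gain * D.a (m + 1) ^ 2 / (D.kbar (m + 1) * (D.N (m + 1) : ℝ) ^ 4)) :=
        div_le_div_of_nonneg_left (by positivity) hpos hlow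
    _ = D.cellVisc (m + 1) / D.gain := by
        unfold FractalCarrierData.cellVisc
        field_simp

/-- **Consecutive renormalised viscosities**: `kbar_{m+1} / kbar_m ≤ cellVisc_{m+1}² / gain`. [cite: ArmstrongVicol2025, §3 (3.42)–(3.43)] -/
theorem kbar_succ_div_le (hP : D.Permissible) (m : ℕ) :
    D.kbar (m + 1) / D.kbar m ≤ D.cellVisc (m + 1) ^ 2 / D.gain := by
  have hk := D.kbar_pos m
  have hk' := D.kbar_pos (m + 1)
  have hg := D.gain_pos
  have ha := D.a_pos (m + 1)
  have hN : (0 : ℝ) < D.N (m + 1) := by exact_mod_cast D.N_pos (m + 1)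
  have hlow := gainTerm_le_kbar D hP m
  have hpos : 0 < D.gain * D.a (m + 1) ^ 2 / (D.kbar (m + 1) * (D.N (m + 1) : ℝ) ^ 4) := by positivity
  calc D.kbar (m + 1) / D.kbar m
      ≤ D.kbar (m + 1) / (D.gain * D.a (m + 1) ^ 2 / (D.kbar (m + 1) * (D.N (m + 1) : ℝ) ^ 4)) :=
        div_le_div_of_nonneg_left hk'.le hpos hlow
    _ = D.cellVisc (m + 1) ^ 2 / D.gain := by
        unfold FractalCarrierData.cellVisc
        field_simp

/-- **Contraction of the potential scales**: `p_{m+2} ≤ (cellVisc_{m+2} · cellVisc_{m+1} / gain) · p_{m+1}`. [folklore] -/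
theorem potentialScale_succ_le (hP : D.Permissible) (m : ℕ) :
    D.a (m + 2) / (D.N (m + 2) : ℝ) ^ 2 ≤
      (D.cellVisc (m + 2) * D.cellVisc (m + 1) / D.gain) * (D.a (m + 1) / (D.N (m + 1) : ℝ) ^ 2) := by
  rw [potentialScale_eq D (m + 2), potentialScale_eq D (m + 1)]
  have hc1 := cellVisc_pos' D (m + 1)
  have hc2 := cellVisc_pos' D (m + 2)
  have hk1 := D.kbar_pos (m + 1)
  have hg := D.gain_pos
  have hr := kbar_succ_div_le D hP (m + 1)
  -- `kbar_{m+2} ≤ (cellVisc_{m+2}²/gain) kbar_{m+1}`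
  have h1 : D.kbar (m + 2) ≤ D.cellVisc (m + 2) ^ 2 / D.gain * D.kbar (m + 1) := by
    have := (div_le_iff₀ hk1).1 hr
    simpa [mul_comm] using this
  calc D.kbar (m + 2) / D.cellVisc (m + 2) ≤ (D.cellVisc (m + 2) ^ 2 / D.gain * D.kbar (m + 1)) / D.cellVisc (m + 2) :=
        div_le_div_of_nonneg_right h1 hc2.le
    _ = D.cellVisc (m + 2) * D.cellVisc (m + 1) / D.gain * (D.kbar (m + 1) / D.cellVisc (m + 1)) := by
        field_simp

/-- **The template makes the cell viscosity small**: `cellVisc_{m+1} ≤ N_m^{-1/4}` from (T2) `cellVisc_{m+1} (N_{m+1}/N_m)^{1/4} ≤ 1` and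
`N_m² ≤ N_{m+1}`. [folklore] -/
theorem cellVisc_succ_le_inv_rpow (hT2 : ∀ m, D.cellVisc (m + 1) * ((D.N (m + 1) : ℝ) / D.N m) ^ (1 / 4 : ℝ) ≤ 1)
    (hsq : ∀ m, D.N m ^ 2 ≤ D.N (m + 1)) (m : ℕ) :
    D.cellVisc (m + 1) ≤ ((D.N m : ℝ)) ^ (-(1 / 4 : ℝ)) := by
  have hN : (0 : ℝ) < D.N m := by exact_mod_cast D.N_pos m
  have hN' : (0 : ℝ) < D.N (m + 1) := by exact_mod_cast D.N_pos (m + 1)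
  have hsq' : (D.N m : ℝ) ^ 2 ≤ D.N (m + 1) := by exact_mod_cast hsq m
  have hc := cellVisc_pos' D (m + 1)
  -- `(N_{m+1}/N_m)^{1/4} ≥ N_m^{1/4}`
  have hratio : (D.N m : ℝ) ≤ (D.N (m + 1) : ℝ) / D.N m := by
    rw [le_div_iff₀ hN]
    nlinarith
  have hpow : (D.N m : ℝ) ^ (1 / 4 : ℝ) ≤ ((D.N (m + 1) : ℝ) / D.N m) ^ (1 / 4 : ℝ) :=
    Real.rpow_le_rpow hN.le hratio (by norm_num)
  have hT := hT2 m
  have hp : 0 < (D.N m : ℝ) ^ (1 / 4 : ℝ) := Real.rpow_pos_of_pos hN _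
  have h1 : D.cellVisc (m + 1) * (D.N m : ℝ) ^ (1 / 4 : ℝ) ≤ 1 :=
    le_trans (mul_le_mul_of_nonneg_left hpow hc.le) hT
  rw [Real.rpow_neg hN.le, ← one_div, le_div_iff₀ hp]
  exact h1

/-- … and `N_m ≥ 2^m` (`Permissible`: `N 0 = 1`, `2 N_m ≤ N_{m+1}`), so `cellVisc_{m+1} ≤ 2^{-m/4}`. [folklore] -/
theorem cellVisc_succ_le_half_pow (hP : D.Permissible)
    (hT2 : ∀ m, D.cellVisc (m + 1) * ((D.N (m + 1) : ℝ) / D.N m) ^ (1 / 4 : ℝ) ≤ 1)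
    (hsq : ∀ m, D.N m ^ 2 ≤ D.N (m + 1)) (m : ℕ) :
    D.cellVisc (m + 1) ≤ ((1 / 2 : ℝ) ^ (1 / 4 : ℝ)) ^ m := by
  have h2 : ∀ i, (2 : ℝ) ^ i ≤ D.N i := by
    intro i
    induction i with
    | zero => simp [hP.1]
    | succ i ih =>
      have h := hP.2.2.1 i
      have h' : (2 : ℝ) * D.N i ≤ D.N (i + 1) := by exact_mod_cast h
      calc (2 : ℝ) ^ (i + 1) = 2 * 2 ^ i := by ring
        _ ≤ 2 * (D.N i : ℝ) := by linarith
        _ ≤ D.N (i + 1) := h'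
  have hN : (0 : ℝ) < D.N m := by exact_mod_cast D.N_pos m
  calc D.cellVisc (m + 1) ≤ ((D.N m : ℝ)) ^ (-(1 / 4 : ℝ)) := cellVisc_succ_le_inv_rpow D hT2 hsq m
    _ ≤ ((2 : ℝ) ^ m) ^ (-(1 / 4 : ℝ)) :=
        Real.rpow_le_rpow_of_nonpos (by positivity) (h2 m) (by norm_num)
    _ = ((1 / 2 : ℝ) ^ (1 / 4 : ℝ)) ^ m := by
        have e1 : (((2 : ℝ) ^ m) : ℝ) ^ (-(1 / 4 : ℝ)) = (2 : ℝ) ^ ((m : ℝ) * (-(1 / 4 : ℝ))) := by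
          rw [← Real.rpow_natCast, ← Real.rpow_mul (by norm_num)]
        have e2 : ((1 / 2 : ℝ) ^ (1 / 4 : ℝ)) ^ m = (2 : ℝ) ^ ((-(1 / 4 : ℝ)) * (m : ℝ)) := by
          rw [one_div, Real.inv_rpow (by norm_num), ← Real.rpow_neg (by norm_num), ← Real.rpow_natCast,
            ← Real.rpow_mul (by norm_num)]
        rw [e1, e2, mul_comm]

/-- **The potential ratio tends to zero along the template**: `(a_{m+1}/N_{m+1}²)/kbar_m ≤ 2^{-m/4}/gain`. [folklore] -/
theorem potentialScale_div_kbar_le_half_pow (hP : D.Permissible)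
    (hT2 : ∀ m, D.cellVisc (m + 1) * ((D.N (m + 1) : ℝ) / D.N m) ^ (1 / 4 : ℝ) ≤ 1)
    (hsq : ∀ m, D.N m ^ 2 ≤ D.N (m + 1)) (m : ℕ) :
    D.a (m + 1) / (D.N (m + 1) : ℝ) ^ 2 / D.kbar m ≤ ((1 / 2 : ℝ) ^ (1 / 4 : ℝ)) ^ m / D.gain :=
  (potentialScale_div_kbar_le D hP m).trans
    (div_le_div_of_nonneg_right (cellVisc_succ_le_half_pow D hP hT2 hsq m) D.gain_pos.le)

end Summit.AnomalousDissipation.AnomalousDissipation.Theorems.SolenoidalFractalHomogenisation.LagrangianRenormalisationStep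

end
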